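import Mathlib
import Summits.KontsevichZagierPeriods.Zeta5Search.Families.DualConstantTerm
import Summits.KontsevichZagierPeriods.Zeta5Search.Families.CellularVIMRecurrenceLaws
import HarnessLib

/-!
# ζ(5) search — Families: the dual constant term as a COUNT, and the VIM / ₈π₈^∨ leading coefficients at `n = 1` (kernel)

HONEST FRAMING: systematic search; no irrationality claim unless certified.  Finite combinatorics (seat P2, Families layer);
nothing about the arithmetic of any zeta value; no record moves.

The general recipe behind CONJECTURE D-exact (`Families/DualConstantTerm.lean`, `HOME/pub-zeta5-p2/g6/DUAL-RATES.md`): for a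
seating `σ` with inverse `τ`, write the basic integrand `F_σ^n` in the gap coordinates of the DUAL cell; it becomes
`∏_{finite τ-edges e} (Σ_{w ∈ span e} g_w)^n / ∏_w g_w^n`, and its constant term is the number `dualCount` of ways to pick one
gap from the span of each linear factor so that every gap is picked exactly `n` times (for `n = 1`: the number of perfect
matchings between the finite edges of `τ` and the gaps they cover).  Here, as a computable recursion (`dualCount`) that the
kernel evaluates:
* **`dualCount_pi8dual_one`** — for `₈π₈^∨`: `21` (= Zudilin's `Q₁`, `Families/DualConstantTermInstances`);
* **`dualCount_vim_one`** / **`vim_A_one_eq_dualCount`** — for Brown's `vanishing in the middle' 10-plan (weight 7):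
  `61 = CellularVIMRecurrenceLaws.A 1`, the leading (`ζ(7)`-) coefficient of the first VIM form (tree theorem `A_one`; [BrownZudilin2022,
  §12]) — a kernel instance of D-exact(σ) on a second family.  (Outside the kernel the dual constant terms of VIM for `n ≤ 5` are
  `1, 61, 52921, 94357501, 235634763001, 715362962769061` = `A_zero … A_five` exactly, `HOME/pub-zeta5-p2/g6/ct_general.py`.)
Standard axioms only (`decide`).
-/

namespace Summit.KontsevichZagierPeriods.Zeta5Search.Families.Cellular

/-- The number of ways to choose one index from each list of `spans` so that index `w` is chosen exactly `B w` times
(`B` as a list of remaining multiplicities): the coefficient of `g^B` in `∏_{S ∈ spans} (Σ_{w ∈ S} g_w)`. -/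
def dualCount : List (List ℕ) → List ℕ → ℕ
  | [], B => if B.all (· == 0) then 1 else 0
  | S :: rest, B => (S.map fun w => if B.getD w 0 = 0 then 0 else dualCount rest (B.set w (B.getD w 0 - 1))).sum

/-- The finite `τδ⁰`-chords of the dual cell of `₈π₈^∨` (`τ = ₈π₈ = (3,1,6,2,5,7,4,0)`), as gap spans. -/
def pi8dualSpans : List (List ℕ) := [[1, 2], [1, 2, 3, 4, 5], [2, 3, 4, 5], [2, 3, 4], [0, 1, 2, 3], [0, 1, 2]]

/-- The finite `τδ⁰`-chords of the dual cell of the VIM plan `(10,2,4,1,6,3,8,5,9,7)` (`τ = (3,1,5,2,7,4,9,6,8,0)`), as gap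
spans over the eight gaps `g₀,…,g₇`. -/
def vimSpans : List (List ℕ) :=
  [[1, 2], [1, 2, 3, 4], [2, 3, 4], [2, 3, 4, 5, 6], [4, 5, 6], [6, 7], [0, 1, 2, 3, 4, 5, 6, 7], [0, 1, 2]]

/-- `n = 1` for `₈π₈^∨`: `21` perfect matchings between the six finite edges of `₈π₈` and the six gaps (= `Q₁`). -/
theorem dualCount_pi8dual_one : dualCount pi8dualSpans [1, 1, 1, 1, 1, 1] = 21 := by decide

/-- `n = 1` for VIM: `61` perfect matchings between the eight finite edges of the dual plan and the eight gaps. -/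
theorem dualCount_vim_one : dualCount vimSpans [1, 1, 1, 1, 1, 1, 1, 1] = 61 := by decide

/-- **D-exact(σ) instance on the VIM family (kernel)**: the leading (`ζ(7)`-) coefficient of the first VIM linear form,
`CellularVIMRecurrenceLaws.A 1 = 61` (`Families/CellularVIMRecurrenceLaws.A_one`), equals the `n = 1` dual constant term of the VIM
integrand. -/
theorem vim_A_one_eq_dualCount : CellularVIMRecurrenceLaws.A 1 = (dualCount vimSpans [1, 1, 1, 1, 1, 1, 1, 1] : ℤ) := by
  rw [dualCount_vim_one, CellularVIMRecurrenceLaws.A_one]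
  norm_num

end Summit.KontsevichZagierPeriods.Zeta5Search.Families.Cellular
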